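import Literature.NumberTheory.Automorphic.ParabolicInduction
import HarnessLib

/-!
# Frobenius reciprocity on `GL_n(F)`: proof of the named fact `frobenius_reciprocity_gl`

This sibling file of `Literature.NumberTheory.Automorphic.ParabolicInduction` discharges the named
fact `Literature.NumberTheory.Automorphic.frobenius_reciprocity_gl` (Bernstein–Zelevinsky 1977,
Prop. 1.9(b); Casselman 1995, Thm. 3.2.4): for a smooth representation `π` of `GL_n(F)`, `F` a
non-archimedean local field, and any representation `σ` of the standard Levi `Π_a GL_{n_a}(F)`,
`Hom_{GL_n(F)} (π, i_c σ) ≃ₗ[ℂ] Hom_{Π GL_{n_a}(F)} (r̄_c π, σ)`,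
as `theorem frobenius_reciprocity_gl_holds`. The file contains theorems only (no new definitions,
no new named facts).

## The argument (Bernstein–Zelevinsky 1977, 1.8–1.9; Casselman 1995, proof of Thm. 3.2.4)

Write `P = P_c`, `U = U_c = ker ℓ` (`ℓ = leviProjection`, so `P = M ⋉ U` with
`M = Π_a GL_{n_a}(F)` embedded block diagonally), `τ = σ ∘ ℓ ⊗ δ_P^{1/2}` (so `i_c σ = Ind_P^G τ`,
`Representation.parabolicIndGL`, definitionally) and `r̄_c π = π_U ⊗ δ_P^{-1/2}`
(`Representation.normalizedJacquetGL`).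

1. *Frobenius reciprocity for smooth induction* `Hom_G (π, Ind_P^G τ) ≃ₗ Hom_P (π|_P, τ)`
   (Bernstein–Zelevinsky 1976, Prop. 2.28–2.29) is `Representation.frobeniusEquiv`, proved in
   `Literature.NumberTheory.Automorphic.SmoothInduction`.
2. *`δ_P^{1/2}` is trivial on `U`* (Bernstein–Zelevinsky's standing assumption "`θ` trivial on
   `U`", 1977, 1.8, there deduced from `U` being a union of compact subgroups). We prove instead the
   purely algebraic statement that **every** homomorphism from `P_c` to a commutative monoid kills
   `U_c`, over any field with an element `x ∉ {0, 1}` (`map_eq_one_of_mem_unipotentRadicalP`): an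
   element of `U_c` is a product of *block-row unipotents* `1 + B` (`B` supported on the rows of
   one block `a` and the columns of the blocks `> a`; for fixed `a` these form an abelian group,
   `(1 + B)(1 + B') = 1 + (B + B')`), and conjugating `1 + B` by the block scalar matrix
   `diag(x on block a, 1 elsewhere) ∈ P_c` gives `1 + x B`; hence
   `χ(1 + (x - 1) B) = χ(1 + x B) χ(1 - B) = χ(1 + B) χ(1 - B) = 1` for every such `B`.
3. Given 2, a `P`-map `φ : π|_P → τ` satisfies `φ (π u v) = φ v` for `u ∈ U`, so it factors
   through the coinvariants `π_U` (`Representation.Coinvariants.lift`), and the factorisation is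
   `M`-equivariant for the normalised Jacquet action; conversely `ψ ↦ ψ ∘ [·]` is a `P`-map because
   `p = ℓ(p) · u` with `u ∈ U` and `δ_P^{1/2}(p) = δ_P^{1/2}(ℓ p)`
   (`nonempty_frobeniusJacquetEquivGL`).

## References

* I. N. Bernstein, A. V. Zelevinsky, *Induced representations of reductive `p`-adic groups I*,
  Ann. Sci. ÉNS (4) 10 (1977), 441–472: 1.8, Prop. 1.9(b), §2.3. [BernsteinZelevinsky1977]
* I. N. Bernstein, A. V. Zelevinsky, *Representations of the group `GL(n, F)` where `F` is a
  non-archimedean local field*, Russian Math. Surveys 31:3 (1976), 1–68: Prop. 2.28–2.29.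
* W. Casselman, *Introduction to the theory of admissible representations of `p`-adic reductive
  groups* (1995 notes), Thm. 3.2.4.
-/

noncomputable section

open scoped MatrixGroups

namespace Literature.NumberTheory.Automorphic

open Representation

/-! ### Characters of `P_c` are trivial on the unipotent radical `U_c`

A matrix `B` is a *block-row piece at the block `a`* if `B i j = 0` unless `c i = a` and `a < c j`;
this support condition is carried as the hypothesis
`hB : ∀ i j, ¬ (c i = a ∧ a < c j) → B i j = 0` throughout (no definition is introduced). -/

section RowPieces

variable {R : Type*} [CommRing R] {n : Type*} [Fintype n] {α : Type*} [LinearOrder α]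
  (c : n → α)

/-- Two block-row pieces at the same block multiply to zero. [folklore] -/
theorem rowPiece_mul_eq_zero {a : α} {B B' : Matrix n n R}
    (hB : ∀ i j, ¬ (c i = a ∧ a < c j) → B i j = 0)
    (hB' : ∀ i j, ¬ (c i = a ∧ a < c j) → B' i j = 0) : B * B' = 0 := by
  ext i j
  rw [Matrix.mul_apply, Matrix.zero_apply]
  refine Finset.sum_eq_zero fun k _ => ?_
  by_cases h1 : c i = a ∧ a < c k
  · rw [hB' k j (fun h2 => h1.2.ne' h2.1), mul_zero]
  · rw [hB i k h1, zero_mul]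

variable [DecidableEq n]

/-- The **block-row unipotent** `1 + B` of a block-row piece `B` exists as an element of `P_c`: it
is invertible with inverse `1 - B` (as `B² = 0`) and block upper triangular.
(Bernstein–Zelevinsky 1977, §2.1: the groups `U` attached to partitions.) [folklore] -/
theorem exists_coe_eq_one_add {a : α} {B : Matrix n n R}
    (hB : ∀ i j, ¬ (c i = a ∧ a < c j) → B i j = 0) :
    ∃ w : standardParabolicGL R c, ((w : GL n R) : Matrix n n R) = 1 + B := by
  refine ⟨⟨⟨1 + B, 1 - B,
    by rw [add_mul, mul_sub, mul_sub, one_mul, one_mul, mul_one, rowPiece_mul_eq_zero c hB hB,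
      sub_zero, sub_add_cancel],
    by rw [sub_mul, mul_add, mul_add, one_mul, one_mul, mul_one, rowPiece_mul_eq_zero c hB hB,
      add_zero, add_sub_cancel_right]⟩, fun i j hij => ?_⟩, rfl⟩
  have hne : i ≠ j := fun h => hij.ne (congrArg c h).symm
  change (1 + B) i j = 0
  rw [Matrix.add_apply, Matrix.one_apply_ne hne, hB i j, add_zero]
  rintro ⟨h1, h2⟩
  have : c i < c j := by rw [h1]; exact h2
  exact lt_asymm hij this

/-- A block-row unipotent `w = 1 + B ∈ P_c` lies in the unipotent radical `U_c = ker ℓ`: its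
diagonal blocks are identity matrices. [folklore] -/
theorem mem_unipotentRadicalP_of_coe_eq {a : α} {B : Matrix n n R}
    (hB : ∀ i j, ¬ (c i = a ∧ a < c j) → B i j = 0) {w : standardParabolicGL R c}
    (hw : ((w : GL n R) : Matrix n n R) = 1 + B) : w ∈ unipotentRadicalP R c := by
  rw [MonoidHom.mem_ker]
  funext b
  ext i j
  rw [leviProjection_apply_coe, Pi.one_apply, Units.val_one, hw, Matrix.add_apply, hB, add_zero]
  · by_cases h : i = j
    · subst h
      rw [Matrix.one_apply_eq, Matrix.one_apply_eq]
    · rw [Matrix.one_apply_ne h, Matrix.one_apply_ne (fun h' => h (Subtype.ext h'))]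
  · rintro ⟨h1, h2⟩
    have : c (i : n) < c (j : n) := by rw [h1]; exact h2
    rw [i.2, j.2] at this
    exact lt_irrefl b this

/-- The inverse of a block-row unipotent `w = 1 + B ∈ P_c` has matrix `1 - B`. [folklore] -/
theorem coe_inv_of_coe_eq {a : α} {B : Matrix n n R}
    (hB : ∀ i j, ¬ (c i = a ∧ a < c j) → B i j = 0) {w : standardParabolicGL R c}
    (hw : ((w : GL n R) : Matrix n n R) = 1 + B) :
    (((w⁻¹ : standardParabolicGL R c) : GL n R) : Matrix n n R) = 1 - B := by
  rw [Subgroup.coe_inv, Matrix.coe_units_inv, hw]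
  refine Matrix.inv_eq_right_inv ?_
  rw [add_mul, mul_sub, mul_sub, one_mul, one_mul, mul_one, rowPiece_mul_eq_zero c hB hB,
    sub_zero, sub_add_cancel]

/-- Block-row unipotents at a fixed block multiply additively: `(1 + B)(1 + B') = 1 + (B + B')`.
[folklore] -/
theorem eq_mul_of_coe_eq {a : α} {B B' : Matrix n n R}
    (hB : ∀ i j, ¬ (c i = a ∧ a < c j) → B i j = 0)
    (hB' : ∀ i j, ¬ (c i = a ∧ a < c j) → B' i j = 0) {w w' w'' : standardParabolicGL R c}
    (hw : ((w : GL n R) : Matrix n n R) = 1 + B) (hw' : ((w' : GL n R) : Matrix n n R) = 1 + B')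
    (hw'' : ((w'' : GL n R) : Matrix n n R) = 1 + (B + B')) : w'' = w * w' := by
  refine Subtype.ext (Units.ext ?_)
  rw [Subgroup.coe_mul, Units.val_mul, hw, hw', hw'', add_mul, mul_add, mul_add, one_mul, one_mul,
    mul_one, rowPiece_mul_eq_zero c hB hB', add_zero, add_assoc, add_comm B' B]

/-- **Conjugation formula**: for a unit `x`, the block scalar matrix
`t = diag(x on block a, 1 elsewhere) ∈ P_c` satisfies `t (1 + B) t⁻¹ = 1 + x B` for every block-row
piece `B` at `a` (the rows of block `a` are multiplied by `x`, the columns of the blocks `> a` are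
untouched). [folklore] -/
theorem exists_conj_eq_of_coe_eq (a : α) (x : Rˣ) :
    ∃ t : standardParabolicGL R c, ∀ (B : Matrix n n R),
      (∀ i j, ¬ (c i = a ∧ a < c j) → B i j = 0) → ∀ {w w' : standardParabolicGL R c},
        ((w : GL n R) : Matrix n n R) = 1 + B →
          ((w' : GL n R) : Matrix n n R) = 1 + (x : R) • B → t * w * t⁻¹ = w' := by
  have hd : ∀ y z : Rˣ, (y : R) * z = 1 →
      (Matrix.diagonal fun i => if c i = a then (y : R) else 1) *
        (Matrix.diagonal fun i => if c i = a then (z : R) else 1) = 1 := fun y z h => by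
    rw [Matrix.diagonal_mul_diagonal, ← Matrix.diagonal_one]
    congr 1
    funext i
    split_ifs <;> simp [h]
  refine ⟨⟨⟨Matrix.diagonal fun i => if c i = a then (x : R) else 1,
    Matrix.diagonal fun i => if c i = a then ((x⁻¹ : Rˣ) : R) else 1, hd _ _ (Units.mul_inv x),
    hd _ _ (Units.inv_mul x)⟩, Matrix.blockTriangular_diagonal _⟩, fun B hB w w' hw hw' => ?_⟩
  refine Subtype.ext (Units.ext ?_)
  rw [Subgroup.coe_mul, Subgroup.coe_mul, Units.val_mul, Units.val_mul, hw, hw']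
  change (Matrix.diagonal fun i => if c i = a then (x : R) else 1) * (1 + B) *
      (Matrix.diagonal fun i => if c i = a then ((x⁻¹ : Rˣ) : R) else 1) = 1 + (x : R) • B
  rw [mul_add, mul_one, add_mul, hd _ _ (Units.mul_inv x)]
  ext i j
  rw [Matrix.add_apply, Matrix.add_apply, Matrix.mul_diagonal, Matrix.diagonal_mul,
    Matrix.smul_apply, smul_eq_mul]
  by_cases h : c i = a ∧ a < c j
  · rw [if_pos h.1, if_neg h.2.ne', mul_one]
  · rw [hB i j h, mul_zero, zero_mul, mul_zero]

/-- The entries of an element of `U_c` inside a diagonal block are those of the identity matrix.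
[folklore] -/
theorem entry_eq_of_mem_unipotentRadicalP {u : standardParabolicGL R c}
    (hu : u ∈ unipotentRadicalP R c) {k j : n} (hkj : c k = c j) :
    ((u : GL n R) : Matrix n n R) k j = if k = j then 1 else 0 := by
  have h : leviProjection R c u = 1 := MonoidHom.mem_ker.1 hu
  have h2 : (Units.val (leviProjection R c u (c j)) : Matrix {i // c i = c j} {i // c i = c j} R)
      ⟨k, hkj⟩ ⟨j, rfl⟩ = (1 : Matrix {i // c i = c j} {i // c i = c j} R) ⟨k, hkj⟩ ⟨j, rfl⟩ := by
    rw [h]; rfl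
  rw [leviProjection_apply_coe] at h2
  rw [h2]
  by_cases hkj' : k = j
  · subst hkj'
    rw [Matrix.one_apply_eq, if_pos rfl]
  · rw [Matrix.one_apply_ne (fun h' => hkj' (congrArg Subtype.val h')), if_neg hkj']

/-- **Every character of `P_c` kills the block-row unipotents.** For a homomorphism `χ` from `P_c`
to a commutative monoid, a field element `x ∉ {0, 1}` and a block-row piece `B = (x - 1) B₀`:
`1 + B = (1 + x B₀)(1 - B₀) = t (1 + B₀) t⁻¹ · (1 - B₀)`, so
`χ(1 + B) = χ(1 + B₀) χ(1 - B₀) = χ(1) = 1`. (The mechanism replacing Bernstein–Zelevinsky's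
standing assumption "`θ` is trivial on `U`", 1977, 1.8, for `GL_n`.) [folklore] -/
theorem map_eq_one_of_coe_eq_one_add {K : Type*} [Field K] {m : Type*} [Fintype m]
    [DecidableEq m] (b : m → α) {A : Type*} [CommMonoid A] (χ : standardParabolicGL K b →* A)
    (hx : ∃ x : K, x ≠ 0 ∧ x ≠ 1) {a : α} {B : Matrix m m K}
    (hB : ∀ i j, ¬ (b i = a ∧ a < b j) → B i j = 0) {w : standardParabolicGL K b}
    (hw : ((w : GL m K) : Matrix m m K) = 1 + B) : χ w = 1 := by
  obtain ⟨x, hx0, hx1⟩ := hx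
  obtain ⟨t, ht⟩ := exists_conj_eq_of_coe_eq b a (Units.mk0 x hx0)
  set B₀ : Matrix m m K := (x - 1)⁻¹ • B with hB₀
  have hB₀c : ∀ i j, ¬ (b i = a ∧ a < b j) → B₀ i j = 0 := fun i j h => by
    rw [hB₀, Matrix.smul_apply, hB i j h, smul_zero]
  have hc : ∀ (y : K) (i j), ¬ (b i = a ∧ a < b j) → (y • B₀) i j = 0 := fun y i j h => by
    rw [Matrix.smul_apply, hB₀c i j h, smul_zero]
  have hBe : B = x • B₀ + (-1 : K) • B₀ := by
    rw [← add_smul, ← sub_eq_add_neg, hB₀, smul_smul, mul_inv_cancel₀ (sub_ne_zero.2 hx1),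
      one_smul]
  obtain ⟨w₀, hw₀⟩ := exists_coe_eq_one_add b hB₀c
  obtain ⟨w₁, hw₁⟩ := exists_coe_eq_one_add b (hc x)
  obtain ⟨w₂, hw₂⟩ := exists_coe_eq_one_add b (hc (-1))
  have h1 : w = w₁ * w₂ := eq_mul_of_coe_eq b (hc x) (hc (-1)) hw₁ hw₂ (by rw [hw, hBe])
  have h2 : t * w₀ * t⁻¹ = w₁ := ht B₀ hB₀c hw₀ (by rw [hw₁, Units.val_mk0])
  have h3 : (1 : standardParabolicGL K b) = w₀ * w₂ :=
    eq_mul_of_coe_eq b hB₀c (hc (-1)) hw₀ hw₂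
      (by rw [Subgroup.coe_one, Units.val_one, neg_one_smul, add_neg_cancel, add_zero])
  calc χ w = χ w₁ * χ w₂ := by rw [h1, map_mul]
    _ = χ w₀ * χ w₂ := by
      rw [← h2, map_mul, map_mul, mul_right_comm (χ t), ← map_mul, mul_inv_cancel, map_one, one_mul]
    _ = 1 := by rw [← map_mul, ← h3, map_one]

/-- **Every character of `P_c` is trivial on the unipotent radical `U_c`** (over a field with an
element `x ∉ {0, 1}`, e.g. any infinite field): by induction on the set `s` of blocks allowed to
carry non-zero off-diagonal rows, peeling off the block-row unipotent `1 + B` of the largest such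
block `a` (`B` = the rows of block `a` of `u`, columns of the blocks `> a`): `(1 + B)⁻¹ u` has its
off-diagonal-block entries in the rows of the blocks of `s \\ {a}`. In particular the modulus
`δ_{P_c}` and its square root are trivial on `U_c`, which is Bernstein–Zelevinsky's standing
assumption (1977, 1.8) in the case of `GL_n`. [folklore] -/
theorem map_eq_one_of_mem_unipotentRadicalP {K : Type*} [Field K] {m : Type*} [Fintype m]
    [DecidableEq m] (b : m → α) {A : Type*} [CommMonoid A] (χ : standardParabolicGL K b →* A)
    (hx : ∃ x : K, x ≠ 0 ∧ x ≠ 1) {u : standardParabolicGL K b} (hu : u ∈ unipotentRadicalP K b) :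
    χ u = 1 := by
  classical
  suffices H : ∀ (s : Finset α) (u : standardParabolicGL K b), u ∈ unipotentRadicalP K b →
      (∀ i j, b i < b j → b i ∉ s → ((u : GL m K) : Matrix m m K) i j = 0) → χ u = 1 from
    H (Finset.univ.image b) u hu fun i j _ h =>
      absurd (Finset.mem_image_of_mem b (Finset.mem_univ i)) h
  intro s
  induction s using Finset.induction_on_max with
  | empty =>
    intro u hu h0
    have hu1 : u = 1 := by
      refine Subtype.ext (Units.ext (Matrix.ext fun i j => ?_))
      rw [Subgroup.coe_one, Units.val_one]
      rcases lt_trichotomy (b i) (b j) with hlt | heq | hgt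
      · rw [h0 i j hlt (Finset.notMem_empty _), Matrix.one_apply_ne]
        exact fun hij => hlt.ne (congrArg b hij)
      · rw [entry_eq_of_mem_unipotentRadicalP b hu heq, Matrix.one_apply]
      · rw [blockTriangular_of_mem u hgt, Matrix.one_apply_ne]
        exact fun hij => hgt.ne' (congrArg b hij)
    rw [hu1, map_one]
  | insert a s has ih =>
    intro u hu h0
    have hent : ∀ k j, b k = b j → ((u : GL m K) : Matrix m m K) k j = if k = j then 1 else 0 :=
      fun k j hkj => entry_eq_of_mem_unipotentRadicalP b hu hkj
    have htri : ((u : GL m K) : Matrix m m K).BlockTriangular b := blockTriangular_of_mem u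
    set M : Matrix m m K := ((u : GL m K) : Matrix m m K) with hM
    -- the block-row piece of `u` at `a` and its unipotent `w = 1 + B`
    set B : Matrix m m K := Matrix.of fun i j => if b i = a ∧ a < b j then M i j else 0 with hB_def
    have hBa : ∀ i j, B i j = if b i = a ∧ a < b j then M i j else 0 := fun i j => by
      rw [hB_def, Matrix.of_apply]
    have hBc : ∀ i j, ¬ (b i = a ∧ a < b j) → B i j = 0 := fun i j h => by rw [hBa, if_neg h]
    obtain ⟨w, hw⟩ := exists_coe_eq_one_add b hBc
    have hwU : w ∈ unipotentRadicalP K b := mem_unipotentRadicalP_of_coe_eq b hBc hw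
    have hu' : w⁻¹ * u ∈ unipotentRadicalP K b := mul_mem (inv_mem hwU) hu
    have key : χ (w⁻¹ * u) = 1 := by
      refine ih _ hu' fun i j hij his => ?_
      rw [Subgroup.coe_mul, Units.val_mul, coe_inv_of_coe_eq b hBc hw, ← hM, sub_mul, one_mul,
        Matrix.sub_apply, Matrix.mul_apply, sub_eq_zero]
      by_cases hia : b i = a
      · rw [Finset.sum_eq_single j]
        · rw [hBa, if_pos ⟨hia, hia ▸ hij⟩, hent j j rfl, if_pos rfl, mul_one]
        · intro k _ hkj
          rw [hBa]
          split_ifs with hk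
          · rcases lt_trichotomy (b k) (b j) with hlt | heq | hgt
            · rw [h0 k j hlt, mul_zero]
              rw [Finset.mem_insert, not_or]
              exact ⟨hk.2.ne', fun hks => lt_asymm hk.2 (has _ hks)⟩
            · rw [hent k j heq, if_neg hkj, mul_zero]
            · rw [htri hgt, mul_zero]
          · exact zero_mul _
        · exact fun h => absurd (Finset.mem_univ j) h
      · have hz : ∀ k, B i k = 0 := fun k => hBc i k (fun h => hia h.1)
        simp only [hz, zero_mul, Finset.sum_const_zero]
        refine h0 i j hij ?_
        rw [Finset.mem_insert, not_or]
        exact ⟨hia, his⟩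
    rw [← mul_inv_cancel_left w u, map_mul, key, mul_one,
      map_eq_one_of_coe_eq_one_add b χ hx hBc hw]

end RowPieces

/-! ### The modulus of `P_c` is trivial on `U_c` -/

section Modulus

/-- A non-trivially valued field has an element `x ∉ {0, 1}` (any `x ≠ 0` of valuation `< 1`).
[folklore] -/
lemma exists_ne_zero_and_ne_one (F : Type*) [Field F] [ValuativeRel F]
    [ValuativeRel.IsNontrivial F] : ∃ x : F, x ≠ 0 ∧ x ≠ 1 := by
  obtain ⟨x, hx0, hx1⟩ := Valuation.IsNontrivial.exists_lt_one (v := ValuativeRel.valuation F)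
  refine ⟨x, hx0, fun h => ?_⟩
  rw [h, map_one] at hx1
  exact lt_irrefl _ hx1

variable (F : Type*) [Field F] [ValuativeRel F] [TopologicalSpace F] [IsNonarchimedeanLocalField F]
  {n : Type*} [Fintype n] [DecidableEq n] {α : Type*} [LinearOrder α] (c : n → α)

/-- **`δ_{P_c}^{1/2}` is trivial on the unipotent radical `U_c`** of the standard parabolic
`P_c ≤ GL_n(F)`, `F` a non-archimedean local field: the square root of the modulus character is a
homomorphism `P_c →* ℂˣ`, and every such homomorphism kills `U_c`
(`map_eq_one_of_mem_unipotentRadicalP`). This is the `GL_n` case of Bernstein–Zelevinsky's standing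
assumption "`θ` is trivial on `U`" (1977, 1.8), there justified by `U` being a union of compact
subgroups. [folklore] -/
theorem rootDeltaChar_eq_one_of_mem_unipotentRadicalP {u : standardParabolicGL F c}
    (hu : u ∈ unipotentRadicalP F c) : rootDeltaChar (standardParabolicGL F c) u = 1 :=
  map_eq_one_of_mem_unipotentRadicalP c _ (exists_ne_zero_and_ne_one F) hu

/-- **`δ_{P_c}` is trivial on `U_c`** (same argument with the modulus character itself).
(Bernstein–Zelevinsky 1977, 1.8.) [folklore] -/
theorem deltaChar_eq_one_of_mem_unipotentRadicalP {u : standardParabolicGL F c}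
    (hu : u ∈ unipotentRadicalP F c) : deltaChar (standardParabolicGL F c) u = 1 :=
  map_eq_one_of_mem_unipotentRadicalP c _ (exists_ne_zero_and_ne_one F) hu

end Modulus

/-! ### `Hom_P (π|_P, σ ∘ ℓ ⊗ δ^{1/2}) ≃ Hom_M (r̄_c π, σ)` and the discharge -/

section FrobeniusGL

variable {F : Type*} [Field F] [ValuativeRel F] [TopologicalSpace F] [IsNonarchimedeanLocalField F]
  {n : Type*} [Fintype n] [DecidableEq n] {α : Type*} [LinearOrder α] {c : n → α}
  {V W : Type*} [AddCommGroup V] [Module ℂ V] [AddCommGroup W] [Module ℂ W]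
  {π : Representation ℂ (GL n F) V} {σ : Representation ℂ (Π a, GL {i // c i = a} F) W}

/-- A `P_c`-map `φ : π|_{P_c} → σ ∘ ℓ ⊗ δ^{1/2}` is `U_c`-invariant: `φ (π u v) = φ v` for
`u ∈ U_c`, because `ℓ u = 1` and `δ^{1/2}(u) = 1` (`rootDeltaChar_eq_one_of_mem_unipotentRadicalP`).
(Bernstein–Zelevinsky 1977, proof of Prop. 1.9(b).) [folklore] -/
lemma apply_unipotent_of_intertwining
    (φ : IntertwiningMap (π.comp (standardParabolicGL F c).subtype)
      (twist (σ.comp (leviProjection F c)) (rootDeltaChar (standardParabolicGL F c))))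
    (u : unipotentRadicalP F c) (v : V) :
    φ (π ((u : standardParabolicGL F c) : GL n F) v) = φ v := by
  have h := φ.isIntertwining _ _ (u : standardParabolicGL F c) v
  rw [twist_apply, MonoidHom.comp_apply, MonoidHom.comp_apply, (MonoidHom.mem_ker).1 u.2, map_one,
    rootDeltaChar_eq_one_of_mem_unipotentRadicalP F c u.2, Units.val_one, one_smul,
    Module.End.one_apply] at h
  exact h

variable [Fintype α]

/-- The quotient map to the `U_c`-coinvariants turns the action of the Levi embedding into the
normalised Jacquet action up to `δ^{1/2}`: `[π (ℓ-embedding m) w] = δ^{1/2}(m) • r̄_c(m) [w]`.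
[folklore] -/
lemma mk_apply_leviEmbeddingP (m : Π a, GL {i // c i = a} F) (w : V) :
    Coinvariants.mk (restrictUnipotentGL F c π)
        (π ((leviEmbeddingP F c m : standardParabolicGL F c) : GL n F) w) =
      ((rootDeltaChar (standardParabolicGL F c) (leviEmbeddingP F c m) : ℂˣ) : ℂ) •
        normalizedJacquetGL F c π m (Coinvariants.mk (restrictUnipotentGL F c π) w) := by
  rw [normalizedJacquetGL_mk, smul_smul, Units.mul_inv, one_smul]
  rfl

/-- **Backward direction**: for `ψ ∈ Hom_M (r̄_c π, σ)` the composite `ψ ∘ [·] : V → W` is a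
`P_c`-map `π|_{P_c} → σ ∘ ℓ ⊗ δ^{1/2}`, because `p = ℓ(p) · u` with `u ∈ U_c` (`P_c = M_c ⋉ U_c`),
`[π u v] = [v]`, `[π (ℓ p) v] = δ^{1/2}(ℓ p) • (ℓ p) • [v]` for the normalised action, and
`δ^{1/2}(p) = δ^{1/2}(ℓ p)` (`rootDeltaChar_eq_one_of_mem_unipotentRadicalP`).
(Bernstein–Zelevinsky 1977, Prop. 1.9(b); Casselman 1995, Thm. 3.2.4.) [folklore] -/
lemma apply_mk_apply_of_intertwining (ψ : (normalizedJacquetGL F c π).IntertwiningMap σ)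
    (p : standardParabolicGL F c) (v : V) :
    ψ (Coinvariants.mk (restrictUnipotentGL F c π) (π (p : GL n F) v)) =
      ((rootDeltaChar (standardParabolicGL F c) p : ℂˣ) : ℂ) •
        σ (leviProjection F c p) (ψ (Coinvariants.mk (restrictUnipotentGL F c π) v)) := by
  set m := leviProjection F c p with hm
  set u : standardParabolicGL F c := (leviEmbeddingP F c m)⁻¹ * p with hu_def
  have hu : u ∈ unipotentRadicalP F c := by
    rw [MonoidHom.mem_ker, hu_def, map_mul, map_inv, leviProjection_leviEmbeddingP_apply, ← hm,
      inv_mul_cancel]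
  have hp : p = leviEmbeddingP F c m * u := (mul_inv_cancel_left _ _).symm
  have hδ : rootDeltaChar (standardParabolicGL F c) p =
      rootDeltaChar (standardParabolicGL F c) (leviEmbeddingP F c m) := by
    rw [hp, map_mul, rootDeltaChar_eq_one_of_mem_unipotentRadicalP F c hu, mul_one]
  have h1 : π (p : GL n F) v = π ((leviEmbeddingP F c m : standardParabolicGL F c) : GL n F)
      (π ((u : standardParabolicGL F c) : GL n F) v) := by
    rw [← Module.End.mul_apply, ← map_mul, ← Subgroup.coe_mul, ← hp]
  have h3 : Coinvariants.mk (restrictUnipotentGL F c π)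
      (π ((u : standardParabolicGL F c) : GL n F) v) =
        Coinvariants.mk (restrictUnipotentGL F c π) v :=
    Coinvariants.mk_self_apply (restrictUnipotentGL F c π) ⟨u, hu⟩ v
  rw [h1, mk_apply_leviEmbeddingP, h3, map_smul, ψ.isIntertwining, hδ]

variable (π σ) in
/-- **`Hom_{P_c} (π|_{P_c}, σ ∘ ℓ ⊗ δ^{1/2}) ≃ₗ[ℂ] Hom_{Π GL_{n_a}(F)} (r̄_c π, σ)`**. Forward: a
`P_c`-map `φ` is `U_c`-invariant (`apply_unipotent_of_intertwining`), hence factors through the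
`U_c`-coinvariants (`Representation.Coinvariants.lift`), and the factorisation intertwines the
normalised Jacquet action `m • [v] = δ^{-1/2}(m) [π(m) v]` with `σ` (the twists by `δ^{∓ 1/2}`
cancel). Backward: `ψ ↦ ψ ∘ [·]` (`apply_mk_apply_of_intertwining`). The two are mutually inverse
and `ℂ`-linear. This is the second half of the proof of Frobenius reciprocity for normalised
parabolic induction on `GL_n(F)`. (Bernstein–Zelevinsky 1977, Prop. 1.9(b); Casselman 1995,
Thm. 3.2.4.) [folklore] -/
theorem nonempty_frobeniusJacquetEquivGL :
    Nonempty (IntertwiningMap (π.comp (standardParabolicGL F c).subtype)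
        (twist (σ.comp (leviProjection F c)) (rootDeltaChar (standardParabolicGL F c))) ≃ₗ[ℂ]
      (normalizedJacquetGL F c π).IntertwiningMap σ) := by
  refine ⟨{ toFun := fun φ =>
              { toLinearMap := Coinvariants.lift (restrictUnipotentGL F c π) φ.toLinearMap fun u =>
                  LinearMap.ext fun v => apply_unipotent_of_intertwining φ u v
                isIntertwining' := fun m => ?_ }
            invFun := fun ψ =>
              { toLinearMap := ψ.toLinearMap ∘ₗ Coinvariants.mk (restrictUnipotentGL F c π)
                isIntertwining' := fun p => LinearMap.ext fun v => ?_ }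
            map_add' := fun _ _ =>
              IntertwiningMap.ext (Coinvariants.hom_ext (LinearMap.ext fun _ => rfl))
            map_smul' := fun _ _ =>
              IntertwiningMap.ext (Coinvariants.hom_ext (LinearMap.ext fun _ => rfl))
            left_inv := fun _ => IntertwiningMap.ext (LinearMap.ext fun _ => rfl)
            right_inv := fun _ =>
              IntertwiningMap.ext (Coinvariants.hom_ext (LinearMap.ext fun _ => rfl)) }⟩
  · -- the descent of `φ` intertwines `r̄_c π` with `σ`
    refine Coinvariants.hom_ext (LinearMap.ext fun v => ?_)
    have h := φ.isIntertwining _ _ (leviEmbeddingP F c m) v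
    rw [twist_apply, MonoidHom.comp_apply, MonoidHom.comp_apply,
      leviProjection_leviEmbeddingP_apply] at h
    simp only [LinearMap.coe_comp, Function.comp_apply]
    rw [normalizedJacquetGL_mk, map_smul, Coinvariants.lift_mk, Coinvariants.lift_mk,
      IntertwiningMap.coe_toLinearMap]
    change _ • φ (π ((standardParabolicGL F c).subtype (leviEmbeddingP F c m)) v) = _
    rw [h, smul_smul, Units.inv_mul, one_smul]
  · -- `ψ ∘ [·]` is a `P_c`-map
    simp only [LinearMap.coe_comp, Function.comp_apply, IntertwiningMap.coe_toLinearMap]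
    rw [twist_apply, MonoidHom.comp_apply, MonoidHom.comp_apply]
    exact apply_mk_apply_of_intertwining ψ p v

end FrobeniusGL

/-! ### The discharge -/

section Main

variable (F : Type*) [Field F] [ValuativeRel F] [TopologicalSpace F] [IsNonarchimedeanLocalField F]
  {n : Type*} [Fintype n] [DecidableEq n] {α : Type*} [LinearOrder α] [Fintype α] (c : n → α)
  {V W : Type*} [AddCommGroup V] [Module ℂ V] [AddCommGroup W] [Module ℂ W]

/-- **Frobenius reciprocity for `GL_n(F)`** — discharge of the named fact
`frobenius_reciprocity_gl`: for a smooth representation `π` of `GL_n(F)` and a representation `σ`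
of `Π_a GL_{n_a}(F)`,
`Hom_{GL_n(F)} (π, i_c σ) ≃ₗ[ℂ] Hom_{Π GL_{n_a}(F)} (r̄_c π, σ)`,
the composite of Frobenius reciprocity for smooth induction
`Hom_G (π, Ind_P^G τ) ≃ₗ Hom_P (π|_P, τ)`, `τ = σ ∘ ℓ ⊗ δ_P^{1/2}`
(`Representation.frobeniusEquiv`, Bernstein–Zelevinsky 1976, Prop. 2.28–2.29) with the descent to
`U_c`-coinvariants `Hom_P (π|_P, τ) ≃ₗ Hom_M (π_U ⊗ δ_P^{-1/2}, σ)`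
(`nonempty_frobeniusJacquetEquivGL`), the latter using that `δ_P` is trivial on `U_c`
(`rootDeltaChar_eq_one_of_mem_unipotentRadicalP`).
Source: Bernstein–Zelevinsky 1977, 1.9 Proposition (b) ("the functor `r_{U,θ}` is left adjoint to
`I_{U,θ}`: `Hom (r_{U,θ}(π), ρ) = Hom (π, I_{U,θ}(ρ))`", p. 445), specialised as in their
Prop. 2.3(b) to `G = GL(n, F)` and a standard subgroup `G_{n₁} × ⋯ × G_{n_r}` (Example 2.2);
Casselman 1995, Thm. 3.2.4. [cite: BernsteinZelevinsky1977, Prop. 1.9(b)] -/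
theorem frobenius_reciprocity_gl_holds : frobenius_reciprocity_gl (V := V) (W := W) F c :=
  fun _π hπ σ =>
    let ⟨e⟩ := nonempty_frobeniusJacquetEquivGL _ σ
    ⟨(frobeniusEquiv hπ).trans e⟩

end Main

end Literature.NumberTheory.Automorphic
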